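/-
Copyright: the b2b-balaban T⁴-continuum CRUX team, row NE7b OWNER lineage `t4-ne7b-p1` (gen 121). Project licence.
-/
import Summits.QuantumFields.BalabanUV.T4Continuum.Spine.NE7b.SupTorusResponseLocality

/-!
# THE UNCONSTRAINED PROPAGATOR `H⁻¹` OF THE TORUS ACTION IS EXPONENTIALLY LOCAL BLOCK-TO-BLOCK IN `ℓ²` — MESH- AND VOLUME-FREE: for
# `H = (n+1)²(−Δ) + a(n+1)^{−d}(block sums) + V` on `(ℤ∕(n+1)s)^d`, ANY `V ≥ −λ`, a source `f` supported in ONE block `y₀` has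
# `Σ_{B_y}(H⁻¹f)² ≤ m_κ⁻²e^{4dκ}e^{−2κρ_s(y,y₀)}·Σf²` over EVERY block `y`, its coarse read-out `Q′tH⁻¹f` decays at the block-RMS size of `f`;
# exponential profiles convolve on the coarse torus uniformly in the period; and the Schur complement `T = Q′tH⁻¹Q′t*` is INVERTIBLE on the
# two-sided class — the inputs of the fluctuation covariance's locality (sequel (139) `…SupTorusCovarianceLocality`)
# (row NE7b, node U5c; (131)–(135), (137) BY NAME; [folklore])

Cell `pub-balaban`, sub-cell `t4`, spine estimate NE7b (`T4WeightBudget.RelWeightBound`; the cell's OWN estimate — NOT PRINTED in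
[Bałaban 1983–89], NOT PROVED).  Crux-route work under `Spine/NE7b/` by the row OWNER (`t4-ne7b-p1` gen 121, file (138)) under FREEZE
(0)'s crux-prover clause — § [NE7bP1-G120-HANDOFF-FINAL] NEXT «the covariance `H⁻¹ − H⁻¹Q′t*T⁻¹Q′tH⁻¹` block-averaged ((137) twice)»,
first half; NOTHING of Bałaban's is named as a Lean object, valued or asserted; no `T4Continuum/Support` leaf typed; no `def`, no notation
(the action is DISPLAYED; `H⁻¹f` enters as `u` with `Hu = f`; the Schur complement is WRITTEN OUT, its matrix Mathlib's `Matrix.of`); zero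
`sorry`.  Imports (BY NAME): the OWNER's (137) `…SupTorusResponseLocality` (through it (135) `coarse_floor`, (133) `sum_indicator_mul`,
`block_sum_le_total`, `weight_on_block`, (132) `torusDist_bond_lipschitz`, `isPseudoDist_torus`, `torus_sum_exp_le`, (131)
`inverseHessian_weighted_resolvent`), Mathlib's `Matrix.mulVec_injective_iff_isUnit`, `sq_sum_le_card_mul_sum_sq`, `abs_le_of_sq_le_sq'`.

WHY (located).  The fluctuation covariance of the road's block-spin step at a background is `C = H⁻¹ − H⁻¹Q′t*T⁻¹Q′tH⁻¹` (`T = Q′tH⁻¹Q′t*`;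
(100)∕(102)'s displays); its locality is what makes Laplace ∕ cumulant corrections of the integrated step ((116)∕(117)) volume-uniform PER
BLOCK.  The honest mesh-free currency is BLOCK-TO-BLOCK `ℓ²` OPERATOR NORM: a source in the block `y₀`, the response read in block `ℓ²` on
the block `y` — no `(n+1)^{±d∕2}` anywhere.  For `H⁻¹` this is (131)'s weighted resolvent letter with the weight `(κ∕(n+1))ρ_N(·, corner y₀)`:
on the source block the weight is `≤ e^{dκ}`, on the block `y` it is `≥ e^{κρ_s(y,y₀) − dκ}` ((133) `weight_on_block`), so
`e^{2κρ_s − 2dκ}Σ_{B_y}u² ≤ ‖e^{w}u‖² ≤ m_κ⁻²‖e^{w}f‖² ≤ m_κ⁻²e^{2dκ}Σf²`.  Block Cauchy–Schwarz turns this into the decay of the block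
MEANS `(Q′tu)(y)` at the size `√((n+1)^{−d}Σf²)` (the block-RMS of `f`) — the coarse vector that `T⁻¹` then spreads with (135)'s profile;
two exponential profiles on the coarse torus convolve by the triangle inequality of (132)'s distance and (132) `torus_sum_exp_le`; and
`T·T⁻¹ = 1` needs `IsUnit (det T)`, which is (135) `coarse_floor` (`T.mulVec` injective).  The sequel (139) assembles `C`.

WHAT IS PROVED ([folklore]; fine torus `Site d ((n+1)s)`, coarse `Site d s`, `[NeZero s]`; the action DISPLAYED; `bt x = σ_s(blk n (wm x))`;
`m_κ = min(2,a) − λ − 2dκ² − a(e^{2dκ} − 1)`; `ρ_s` = (132)'s `ℓ¹` circular distance written out; `K_δ = (2∕(1 − e^{−δ}))^d`):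
* §1 **`coarse_convolution_le`** (`|F y″| ≤ Ae^{−αρ_s(y,y″)}`, `|G y″| ≤ Be^{−βρ_s(y″,y′)}`, `0 < δ ≤ α`, `2δ ≤ β` ⟹
  `|Σ_{y″}F y″G y″| ≤ A·B·K_δ·e^{−δρ_s(y,y′)}`, every period).
* §2 (`Hu = f`, `f x = 0` unless `bt x = y₀`, `V ≥ −λ`, `0 ≤ κ ≤ 1`, `m_κ > 0`) **`blockSq_le_of_block_source`**
  (`Σ_z u(σ(chart (wm y) z))² ≤ m_κ⁻²e^{4dκ}e^{−2κρ_s(y,y₀)}Σ_x f x²` for every block `y`), **`blockMean_le_of_block_source`**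
  (`|(n+1)^{−d}Σ_z u(σ(chart (wm y) z))| ≤ m_κ⁻¹e^{2dκ}√((n+1)^{−d}Σf²)·e^{−κρ_s(y,y₀)}`).
* §3 (`a > 0`, `−λ ≤ V ≤ Λ`, `λ < min(2,a)`, columns `Hψ_{y′} = 𝟙[bt · = y′]`) **`schur_det_isUnit`**
  (`IsUnit (det (Matrix.of (y,y′ ↦ (n+1)^{−d}Σ_z ψ_{y′}(σ(chart (wm y) z)))))`).
* §4 toy.

HONEST (what this is NOT).  Block-`ℓ²` currency (a pointwise statement would carry `(n+1)^{d∕2}` without an `ℓ^∞` theory — § NEXT (3)(b),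
untouched); sources in ONE block (general sources by linearity and the triangle inequality, not typed); existence of `u = H⁻¹f` is not
re-proved ((100)∕(106) solve; here `u` is taken with its display); constants explicit, far from sharp; cubic periods; scalar skeleton ((A3),
NC-NE7b-α UNRULED); nothing of the covariant propagators of [B4]–[B6]; nothing of Bałaban's.  BY-NAME EFFECT ON THE WALL: NONE.  NE7b NOT
PRINTED ∕ NOT PROVED; spine PROVED 0∕9; rung (B)+1 on a FINITE torus — NOT infinite volume, NOT the mass gap, NOT Clay.  HONEST DEPENDENCY:
continuum YM on T⁴ ⇐ BetaPertH ∧ nine spine estimates (0∕9 proved); BetaPertH ⇐ (D1) ∧ (D4) ∧ CAP+tail; G-an2-4 gates asym, D1 and NE2∕3∕4.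
-/

set_option autoImplicit false

noncomputable section

namespace Summit.QuantumFields.BalabanUV.T4Continuum.NE7b.SupTorusPropagatorLocality

open Real
open Literature.MathematicalPhysics.QuantumFieldTheory.Balaban1983to89
open B6QGQLower276 (X e blk B side chart mem_B sum_B sum_B_const card_cube blk_chart)
open Beta (Site siteOf windowMap siteOf_windowMap siteOf_add)
open SupTorusHessianCombesThomas (inverseHessian_weighted_resolvent)
open SupTorusBlockDistance (torusDist_bond_lipschitz isPseudoDist_torus torus_sum_exp_le)
open SupTorusActionForm (sum_indicator_mul block_sum_le_total weight_on_block)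
open SupTorusCoarseFloor (coarse_floor)

variable {d : ℕ}

/-! ## §1. Exponential profiles convolve on the coarse torus -/

section Coarse

variable (s : ℕ)

/-- **TWO EXPONENTIAL PROFILES CONVOLVE TO AN EXPONENTIAL PROFILE, UNIFORMLY IN THE PERIOD**: if `|F y″| ≤ A·e^{−αρ_s(y,y″)}` and
`|G y″| ≤ B·e^{−βρ_s(y″,y′)}` with `δ ≤ α`, `2δ ≤ β`, `δ > 0`, then `|Σ_{y″} F y″·G y″| ≤ A·B·(2∕(1 − e^{−δ}))^d·e^{−δρ_s(y,y′)}` — the triangle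
inequality of (132)'s `ℓ¹` circular distance and (132) `torus_sum_exp_le`. [folklore] -/
theorem coarse_convolution_le [NeZero s] {α β δ A B : ℝ} (hδ : 0 < δ) (hα : δ ≤ α) (hβ : 2 * δ ≤ β) (hA : 0 ≤ A) (hB : 0 ≤ B)
    (y y' : Site d s) (F G : Site d s → ℝ)
    (hF : ∀ y'', |F y''| ≤ A * exp (-(α * ∑ i, (((y i - y'' i).valMinAbs.natAbs : ℕ) : ℝ))))
    (hG : ∀ y'', |G y''| ≤ B * exp (-(β * ∑ i, (((y'' i - y' i).valMinAbs.natAbs : ℕ) : ℝ)))) :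
    |∑ y'', F y'' * G y''| ≤ A * B * (2 * (1 - exp (-δ))⁻¹) ^ d * exp (-(δ * ∑ i, (((y i - y' i).valMinAbs.natAbs : ℕ) : ℝ))) := by
  have hP := isPseudoDist_torus (d := d) s
  -- termwise: `|F G| ≤ A B e^{−δρ(y,y′)} e^{−δρ(y′,y″)}`
  have hterm : ∀ y'', |F y'' * G y''| ≤ A * B * exp (-(δ * ∑ i, (((y i - y' i).valMinAbs.natAbs : ℕ) : ℝ)))
      * exp (-(δ * ∑ i, (((y' i - y'' i).valMinAbs.natAbs : ℕ) : ℝ))) := by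
    intro y''
    have hρ1 : 0 ≤ ∑ i, (((y i - y'' i).valMinAbs.natAbs : ℕ) : ℝ) := Finset.sum_nonneg fun _ _ => Nat.cast_nonneg _
    have hρ2 : 0 ≤ ∑ i, (((y'' i - y' i).valMinAbs.natAbs : ℕ) : ℝ) := Finset.sum_nonneg fun _ _ => Nat.cast_nonneg _
    have htri := hP.triangle y y'' y'
    have hsym : ∑ i, (((y' i - y'' i).valMinAbs.natAbs : ℕ) : ℝ) = ∑ i, (((y'' i - y' i).valMinAbs.natAbs : ℕ) : ℝ) := hP.symm y' y''
    rw [abs_mul]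
    have h1 : |F y''| * |G y''| ≤ (A * exp (-(α * ∑ i, (((y i - y'' i).valMinAbs.natAbs : ℕ) : ℝ))))
        * (B * exp (-(β * ∑ i, (((y'' i - y' i).valMinAbs.natAbs : ℕ) : ℝ)))) :=
      mul_le_mul (hF y'') (hG y'') (abs_nonneg _) (by positivity)
    refine h1.trans ?_
    rw [hsym, mul_mul_mul_comm, mul_assoc (A * B), ← exp_add, ← exp_add]
    refine mul_le_mul_of_nonneg_left (exp_le_exp.2 ?_) (mul_nonneg hA hB)
    have k1 : 0 ≤ (α - δ) * ∑ i, (((y i - y'' i).valMinAbs.natAbs : ℕ) : ℝ) := mul_nonneg (by linarith) hρ1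
    have k2 : 0 ≤ (β - 2 * δ) * ∑ i, (((y'' i - y' i).valMinAbs.natAbs : ℕ) : ℝ) := mul_nonneg (by linarith) hρ2
    have k3 : 0 ≤ δ * (∑ i, (((y i - y'' i).valMinAbs.natAbs : ℕ) : ℝ) + ∑ i, (((y'' i - y' i).valMinAbs.natAbs : ℕ) : ℝ)
        - ∑ i, (((y i - y' i).valMinAbs.natAbs : ℕ) : ℝ)) := mul_nonneg hδ.le (by linarith)
    linarith [k1, k2, k3]
  -- sum: `Σ_{y″} e^{−δρ(y′,y″)} ≤ K`
  have hK := torus_sum_exp_le (d := d) s hδ y'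
  calc |∑ y'', F y'' * G y''| ≤ ∑ y'', |F y'' * G y''| := Finset.abs_sum_le_sum_abs _ _
    _ ≤ ∑ y'' : Site d s, A * B * exp (-(δ * ∑ i, (((y i - y' i).valMinAbs.natAbs : ℕ) : ℝ)))
        * exp (-(δ * ∑ i, (((y' i - y'' i).valMinAbs.natAbs : ℕ) : ℝ))) := Finset.sum_le_sum fun y'' _ => hterm y''
    _ = A * B * exp (-(δ * ∑ i, (((y i - y' i).valMinAbs.natAbs : ℕ) : ℝ)))
        * ∑ y'' : Site d s, exp (-(δ * ∑ i, (((y' i - y'' i).valMinAbs.natAbs : ℕ) : ℝ))) := (Finset.mul_sum _ _ _).symm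
    _ ≤ A * B * exp (-(δ * ∑ i, (((y i - y' i).valMinAbs.natAbs : ℕ) : ℝ))) * (2 * (1 - exp (-δ))⁻¹) ^ d :=
        mul_le_mul_of_nonneg_left hK (by positivity)
    _ = _ := by ring

end Coarse

/-! ## §2. A source supported in one block: block `ℓ²` locality of `H⁻¹`, and the coarse read-out -/

section Block

variable (n : ℕ) (a : ℝ) (s : ℕ) [NeZero s] (ha : 0 ≤ a) {lam κ : ℝ} (hκ0 : 0 ≤ κ) (hκ1 : κ ≤ 1)
  (hm : 0 < min 2 a - lam - 2 * d * κ ^ 2 - a * (exp (2 * d * κ) - 1))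
  (V : Site d ((n + 1) * s) → ℝ) (hV : ∀ x, -lam ≤ V x) (y₀ : Site d s)
  (u f : Site d ((n + 1) * s) → ℝ)
  (hf : ∀ x, siteOf d s (blk n (windowMap d ((n + 1) * s) x)) ≠ y₀ → f x = 0)
  (hu : ∀ x, ((n : ℝ) + 1) ^ 2 * ∑ μ, (2 * u x - u (x + siteOf d ((n + 1) * s) (e μ)) - u (x - siteOf d ((n + 1) * s) (e μ)))
      + a / ((n : ℝ) + 1) ^ d * ∑ q ∈ B n (blk n (windowMap d ((n + 1) * s) x)), u (siteOf d ((n + 1) * s) q) + V x * u x = f x)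

include ha hκ0 hκ1 hm hV hf hu in
/-- **BLOCK-TO-BLOCK LOCALITY OF `H⁻¹`**: if `Hu = f` (displayed action, `V ≥ −λ`) with `f` supported in the block `y₀` (`f x = 0` unless
`bt x = y₀`), then over EVERY block `y`: `Σ_z u(σ(chart (wm y) z))² ≤ m_κ⁻²·e^{4dκ}·e^{−2κρ_s(y,y₀)}·Σ_x f x²` — (131)'s weighted resolvent
letter with the weight `(κ∕(n+1))ρ_N(·, corner y₀)`: on the source block the weight is `≤ e^{dκ}`, on the block `y` it is `≥ e^{κρ_s(y,y₀) − dκ}`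
((133) `weight_on_block`).  No `ℓ² → ℓ^∞` loss, no volume factor: MESH- AND VOLUME-FREE. [folklore] -/
theorem blockSq_le_of_block_source (y : Site d s) :
    ∑ z : Fin d → Fin (n + 1), u (siteOf d ((n + 1) * s) (chart n (windowMap d s y) z)) ^ 2
      ≤ ((min 2 a - lam - 2 * d * κ ^ 2 - a * (exp (2 * d * κ) - 1))⁻¹) ^ 2 * exp (4 * d * κ)
        * exp (-(2 * κ * ∑ i, (((y i - y₀ i).valMinAbs.natAbs : ℕ) : ℝ))) * ∑ x, f x ^ 2 := by
  classical
  set m := min 2 a - lam - 2 * d * κ ^ 2 - a * (exp (2 * d * κ) - 1) with hm_def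
  set c' : Site d ((n + 1) * s) := siteOf d ((n + 1) * s) (chart n (windowMap d s y₀) 0) with hc'
  set ρ : Site d ((n + 1) * s) → ℝ := fun x => ∑ i, (((x i - c' i).valMinAbs.natAbs : ℕ) : ℝ) with hρ_def
  have hρ : ∀ x μ, |ρ (x + siteOf d ((n + 1) * s) (e μ)) - ρ x| ≤ 1 := fun x μ => torusDist_bond_lipschitz ((n + 1) * s) x c' μ
  have hres := inverseHessian_weighted_resolvent n a s ha hκ0 hκ1 hm V hV ρ hρ u f hu
  -- the source: supported in the block `y₀`, where the weight is `≤ e^{dκ}`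
  have hsrc : ∑ x, (exp (κ / ((n : ℝ) + 1) * ρ x) * f x) ^ 2 ≤ exp (2 * d * κ) * ∑ x, f x ^ 2 := by
    have e1 : ∀ x, (exp (κ / ((n : ℝ) + 1) * ρ x) * f x) ^ 2
        = (if siteOf d s (blk n (windowMap d ((n + 1) * s) x)) = y₀ then (1 : ℝ) else 0)
          * (exp (κ / ((n : ℝ) + 1) * ρ x) ^ 2 * f x ^ 2) := by
      intro x
      by_cases hx : siteOf d s (blk n (windowMap d ((n + 1) * s) x)) = y₀
      · rw [if_pos hx, one_mul, mul_pow]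
      · rw [if_neg hx, hf x hx]; ring
    have e2 : ∀ x, f x ^ 2 = (if siteOf d s (blk n (windowMap d ((n + 1) * s) x)) = y₀ then (1 : ℝ) else 0) * f x ^ 2 := by
      intro x
      by_cases hx : siteOf d s (blk n (windowMap d ((n + 1) * s) x)) = y₀
      · rw [if_pos hx, one_mul]
      · rw [if_neg hx, hf x hx]; ring
    rw [Finset.sum_congr rfl fun x _ => e1 x, sum_indicator_mul n s y₀,
      Finset.sum_congr rfl fun x (_ : x ∈ Finset.univ) => e2 x, sum_indicator_mul n s y₀, Finset.mul_sum]
    refine Finset.sum_le_sum fun z _ => mul_le_mul_of_nonneg_right ?_ (sq_nonneg _)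
    have hw := (weight_on_block n s y₀ y₀ z hκ0).2
    rw [(isPseudoDist_torus (d := d) s).zero y₀, mul_zero, zero_add] at hw
    rw [← exp_nat_mul, Nat.cast_ofNat]
    exact exp_le_exp.2 (by simp only [hρ_def, hc'] at hw ⊢; linarith)
  -- the solution on the block `y`: weights `≥ e^{κρ_s − dκ}`
  have hsol : exp (2 * (κ * (∑ i, (((y i - y₀ i).valMinAbs.natAbs : ℕ) : ℝ)) - d * κ))
        * ∑ z : Fin d → Fin (n + 1), u (siteOf d ((n + 1) * s) (chart n (windowMap d s y) z)) ^ 2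
      ≤ ∑ x, (exp (κ / ((n : ℝ) + 1) * ρ x) * u x) ^ 2 := by
    rw [Finset.mul_sum]
    refine le_trans (Finset.sum_le_sum fun z _ => ?_)
      (block_sum_le_total n s y (F := fun x => (exp (κ / ((n : ℝ) + 1) * ρ x) * u x) ^ 2) fun x => sq_nonneg _)
    have hw := (weight_on_block n s y y₀ z hκ0).1
    simp only [hρ_def, hc']
    rw [mul_pow, ← exp_nat_mul, Nat.cast_ofNat]
    exact mul_le_mul_of_nonneg_right (exp_le_exp.2 (by linarith)) (sq_nonneg _)
  -- combine
  have hS0 : 0 ≤ ∑ x, (exp (κ / ((n : ℝ) + 1) * ρ x) * u x) ^ 2 := Finset.sum_nonneg fun _ _ => sq_nonneg _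
  have hF0 : 0 ≤ ∑ x, (exp (κ / ((n : ℝ) + 1) * ρ x) * f x) ^ 2 := Finset.sum_nonneg fun _ _ => sq_nonneg _
  have hsq : ∑ x, (exp (κ / ((n : ℝ) + 1) * ρ x) * u x) ^ 2 ≤ (m⁻¹) ^ 2 * (exp (2 * d * κ) * ∑ x, f x ^ 2) := by
    have h1 := pow_le_pow_left₀ (Real.sqrt_nonneg _) hres 2
    rw [Real.sq_sqrt hS0, mul_pow, Real.sq_sqrt hF0] at h1
    exact h1.trans (mul_le_mul_of_nonneg_left hsrc (sq_nonneg _))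
  have hexp : 0 < exp (2 * (κ * (∑ i, (((y i - y₀ i).valMinAbs.natAbs : ℕ) : ℝ)) - d * κ)) := exp_pos _
  have key : ∑ z : Fin d → Fin (n + 1), u (siteOf d ((n + 1) * s) (chart n (windowMap d s y) z)) ^ 2
      ≤ (m⁻¹) ^ 2 * (exp (2 * d * κ) * ∑ x, f x ^ 2)
        / exp (2 * (κ * (∑ i, (((y i - y₀ i).valMinAbs.natAbs : ℕ) : ℝ)) - d * κ)) := by
    rw [le_div_iff₀ hexp, mul_comm]
    exact hsol.trans hsq
  refine key.trans (le_of_eq ?_)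
  rw [div_eq_iff hexp.ne']
  have hE : exp (4 * d * κ) * exp (-(2 * κ * ∑ i, (((y i - y₀ i).valMinAbs.natAbs : ℕ) : ℝ)))
      * exp (2 * (κ * (∑ i, (((y i - y₀ i).valMinAbs.natAbs : ℕ) : ℝ)) - d * κ)) = exp (2 * d * κ) := by
    rw [← exp_add, ← exp_add]; congr 1; ring
  calc (m⁻¹) ^ 2 * (exp (2 * d * κ) * ∑ x, f x ^ 2) = (m⁻¹) ^ 2 * (exp (4 * d * κ)
        * exp (-(2 * κ * ∑ i, (((y i - y₀ i).valMinAbs.natAbs : ℕ) : ℝ)))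
        * exp (2 * (κ * (∑ i, (((y i - y₀ i).valMinAbs.natAbs : ℕ) : ℝ)) - d * κ))) * ∑ x, f x ^ 2 := by rw [hE]; ring
    _ = _ := by ring

include ha hκ0 hκ1 hm hV hf hu in
/-- **THE COARSE READ-OUT `Q′tH⁻¹` OF A BLOCK SOURCE DECAYS**: the block means of `u` satisfy
`|(n+1)^{−d}Σ_z u(σ(chart (wm y) z))| ≤ m_κ⁻¹e^{2dκ}·√((n+1)^{−d}Σ_x f x²)·e^{−κρ_s(y,y₀)}` (block Cauchy–Schwarz on
`blockSq_le_of_block_source`; the factor `√((n+1)^{−d}Σf²)` is the block-RMS size of the source). [folklore] -/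
theorem blockMean_le_of_block_source (y : Site d s) :
    |(((n : ℝ) + 1) ^ d)⁻¹ * ∑ z : Fin d → Fin (n + 1), u (siteOf d ((n + 1) * s) (chart n (windowMap d s y) z))|
      ≤ (min 2 a - lam - 2 * d * κ ^ 2 - a * (exp (2 * d * κ) - 1))⁻¹ * exp (2 * d * κ)
          * √((((n : ℝ) + 1) ^ d)⁻¹ * ∑ x, f x ^ 2)
        * exp (-(κ * ∑ i, (((y i - y₀ i).valMinAbs.natAbs : ℕ) : ℝ))) := by
  classical
  set m := min 2 a - lam - 2 * d * κ ^ 2 - a * (exp (2 * d * κ) - 1) with hm_def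
  have hvol : (0 : ℝ) < ((n : ℝ) + 1) ^ d := by positivity
  have hblock := blockSq_le_of_block_source n a s ha hκ0 hκ1 hm V hV y₀ u f hf hu y
  have hCS := sq_sum_le_card_mul_sum_sq (s := (Finset.univ : Finset (Fin d → Fin (n + 1))))
    (f := fun z => u (siteOf d ((n + 1) * s) (chart n (windowMap d s y) z)))
  rw [Finset.card_univ, card_cube] at hCS
  have hF : 0 ≤ ∑ x, f x ^ 2 := Finset.sum_nonneg fun _ _ => sq_nonneg _
  have hR : 0 ≤ m⁻¹ * exp (2 * d * κ) * √((((n : ℝ) + 1) ^ d)⁻¹ * ∑ x, f x ^ 2)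
      * exp (-(κ * ∑ i, (((y i - y₀ i).valMinAbs.natAbs : ℕ) : ℝ))) := by
    have : 0 ≤ m⁻¹ := inv_nonneg.2 hm.le
    positivity
  -- squares: `((n+1)^{−d}Σu)² ≤ (n+1)^{−d}Σ_z u² ≤ (n+1)^{−d}·m⁻²e^{4dκ}e^{−2κρ}Σf² = R²`
  have hsq : ((((n : ℝ) + 1) ^ d)⁻¹ * ∑ z : Fin d → Fin (n + 1), u (siteOf d ((n + 1) * s) (chart n (windowMap d s y) z))) ^ 2
      ≤ (m⁻¹ * exp (2 * d * κ) * √((((n : ℝ) + 1) ^ d)⁻¹ * ∑ x, f x ^ 2)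
          * exp (-(κ * ∑ i, (((y i - y₀ i).valMinAbs.natAbs : ℕ) : ℝ)))) ^ 2 := by
    have h4 : exp (4 * d * κ) = exp (2 * d * κ) ^ 2 := by rw [sq, ← exp_add]; ring_nf
    have h5 : exp (-(2 * κ * ∑ i, (((y i - y₀ i).valMinAbs.natAbs : ℕ) : ℝ)))
        = exp (-(κ * ∑ i, (((y i - y₀ i).valMinAbs.natAbs : ℕ) : ℝ))) ^ 2 := by rw [sq, ← exp_add]; ring_nf
    have hroot : √((((n : ℝ) + 1) ^ d)⁻¹ * ∑ x, f x ^ 2) ^ 2 = (((n : ℝ) + 1) ^ d)⁻¹ * ∑ x, f x ^ 2 :=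
      Real.sq_sqrt (mul_nonneg (inv_nonneg.2 hvol.le) hF)
    calc ((((n : ℝ) + 1) ^ d)⁻¹ * ∑ z : Fin d → Fin (n + 1), u (siteOf d ((n + 1) * s) (chart n (windowMap d s y) z))) ^ 2
        = (((n : ℝ) + 1) ^ d)⁻¹ ^ 2 * (∑ z : Fin d → Fin (n + 1), u (siteOf d ((n + 1) * s) (chart n (windowMap d s y) z))) ^ 2 := by
          rw [mul_pow]
      _ ≤ (((n : ℝ) + 1) ^ d)⁻¹ ^ 2 * (((n : ℝ) + 1) ^ d
          * ∑ z : Fin d → Fin (n + 1), u (siteOf d ((n + 1) * s) (chart n (windowMap d s y) z)) ^ 2) :=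
          mul_le_mul_of_nonneg_left hCS (sq_nonneg _)
      _ = (((n : ℝ) + 1) ^ d)⁻¹ * ∑ z : Fin d → Fin (n + 1), u (siteOf d ((n + 1) * s) (chart n (windowMap d s y) z)) ^ 2 := by
          field_simp
      _ ≤ (((n : ℝ) + 1) ^ d)⁻¹ * (((m)⁻¹) ^ 2 * exp (4 * d * κ)
          * exp (-(2 * κ * ∑ i, (((y i - y₀ i).valMinAbs.natAbs : ℕ) : ℝ))) * ∑ x, f x ^ 2) :=
          mul_le_mul_of_nonneg_left hblock (inv_nonneg.2 hvol.le)
      _ = _ := by rw [mul_pow, mul_pow, mul_pow, hroot, h4, h5]; ring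
  have habs := abs_le_of_sq_le_sq' hsq hR
  exact abs_le.2 habs

end Block

/-! ## §3. The Schur complement is invertible on the two-sided class (the coarse floor) -/

section Unit

variable (n : ℕ) (a : ℝ) (s : ℕ) [NeZero s] (ha : 0 < a) {lam Lam : ℝ} (hlam : lam < min 2 a) (hLam : 0 ≤ Lam)
  (V : Site d ((n + 1) * s) → ℝ) (hV : ∀ x, -lam ≤ V x) (hV' : ∀ x, V x ≤ Lam)
  (ψ : Site d s → Site d ((n + 1) * s) → ℝ)
  (hψ : ∀ y' x, ((n : ℝ) + 1) ^ 2 * ∑ μ, (2 * ψ y' x - ψ y' (x + siteOf d ((n + 1) * s) (e μ)) - ψ y' (x - siteOf d ((n + 1) * s) (e μ)))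
      + a / ((n : ℝ) + 1) ^ d * ∑ q ∈ B n (blk n (windowMap d ((n + 1) * s) x)), ψ y' (siteOf d ((n + 1) * s) q) + V x * ψ y' x
      = if siteOf d s (blk n (windowMap d ((n + 1) * s) x)) = y' then 1 else 0)

include ha hlam hLam hV hV' hψ in
/-- **THE SCHUR COMPLEMENT IS INVERTIBLE** on the two-sided class: the coarse floor ((135) `coarse_floor`) makes `T.mulVec` injective, hence
`IsUnit (det T)` for `T = Matrix.of (y,y′ ↦ (n+1)^{−d}Σ_z ψ_{y′}(σ(chart (wm y) z)))` (Mathlib `Matrix.mulVec_injective_iff_isUnit`). [folklore] -/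
theorem schur_det_isUnit :
    IsUnit (Matrix.of fun y y' : Site d s =>
      (((n : ℝ) + 1) ^ d)⁻¹ * ∑ z : Fin d → Fin (n + 1), ψ y' (siteOf d ((n + 1) * s) (chart n (windowMap d s y) z))).det := by
  classical
  set T : Matrix (Site d s) (Site d s) ℝ := Matrix.of fun yy y'' : Site d s =>
    (((n : ℝ) + 1) ^ d)⁻¹ * ∑ z : Fin d → Fin (n + 1), ψ y'' (siteOf d ((n + 1) * s) (chart n (windowMap d s yy) z)) with hT_def
  have hd : (0 : ℝ) ≤ d := Nat.cast_nonneg d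
  have hfloor := coarse_floor n a s ha hlam.le hLam V hV hV' ψ hψ
  have hinj : Function.Injective T.mulVec := by
    intro g₁ g₂ hg
    have hg0 : T.mulVec (g₁ - g₂) = 0 := by rw [Matrix.mulVec_sub, hg, sub_self]
    have hq : ∑ y, (g₁ - g₂) y * T.mulVec (g₁ - g₂) y = 0 := by rw [hg0]; simp
    have hfl := hfloor (g₁ - g₂)
    have hform : ∑ y, (g₁ - g₂) y * ∑ y', ((((n : ℝ) + 1) ^ d)⁻¹
        * ∑ z : Fin d → Fin (n + 1), ψ y' (siteOf d ((n + 1) * s) (chart n (windowMap d s y) z))) * (g₁ - g₂) y'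
        = ∑ y, (g₁ - g₂) y * T.mulVec (g₁ - g₂) y := by
      simp only [hT_def, Matrix.mulVec, dotProduct, Matrix.of_apply]
    rw [hform, hq] at hfl
    have hpos : 0 < 1 / ((36 : ℝ) ^ d * (4 * d + a + Lam)) := by positivity
    have hS : ∑ y, (g₁ - g₂) y ^ 2 ≤ 0 := not_lt.1 fun hne => (not_le.2 (mul_pos hpos hne)) hfl
    funext y
    have hy : (g₁ - g₂) y ^ 2 ≤ 0 := (Finset.single_le_sum (fun y _ => sq_nonneg ((g₁ - g₂) y)) (Finset.mem_univ y)).trans hS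
    have : (g₁ - g₂) y = 0 := by nlinarith [sq_nonneg ((g₁ - g₂) y)]
    simpa [sub_eq_zero] using this
  exact (Matrix.isUnit_iff_isUnit_det T).1 (Matrix.mulVec_injective_iff_isUnit.1 hinj)

end Unit

/-! ## §4. Toy -/

/-- Toy (every period `s`, `d = 2`): two ZERO profiles convolve to the zero profile — `coarse_convolution_le` with every slot inhabited
(`A = B = 0`, rates `α = 1 ≥ δ = 1`, `β = 2 ≥ 2δ`). -/
example (s : ℕ) [NeZero s] (y y' : Site 2 s) :
    |∑ y'' : Site 2 s, (fun _ => (0 : ℝ)) y'' * (fun _ => (0 : ℝ)) y''|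
      ≤ 0 * 0 * (2 * (1 - exp (-1))⁻¹) ^ 2 * exp (-(1 * ∑ i, (((y i - y' i).valMinAbs.natAbs : ℕ) : ℝ))) :=
  coarse_convolution_le (d := 2) s (α := 1) (β := 2) (δ := 1) (A := 0) (B := 0) one_pos le_rfl (by norm_num) le_rfl le_rfl y y' _ _
    (fun _ => by simp) (fun _ => by simp)

end Summit.QuantumFields.BalabanUV.T4Continuum.NE7b.SupTorusPropagatorLocality
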